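import Mathlib
import HarnessLib
import Summits.HubbardSuperconductivity.HubbardSuperconductivity.Theorems.KLProgrammeSWaveCascadeDefs

/-!
# Route `KLProgramme` — the weighted max-entry algebra of Cooper arrays: submultiplicativity, the s-wave identities, the
# averaging projections and the four blocks (lemmas for `KLProgrammeSWaveCascade.lean`)

Cell gate-hubbard-kl, seat p3.  Everything is elementary finite-sum algebra over the definitions of
`KLProgrammeSWaveCascadeDefs.lean`:

* `le_esup`, `esup_le`, `esup_nonneg`, `esup_add_le`, `esup_sub_le`, `esup_smul_le`; bilinearity of `wmul`;
  `wmul_onesArr_left/right/onesArr` (`J ∗_w A = W·P_L A`, `A ∗_w J = W·P_R A`, `J ∗_w J = W·J`); **`esup_wmul_le`**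
  (`esup (A ∗_w B) ≤ esup A · W · esup B`, `w ≥ 0`);
* linearity, idempotence and commutation of `P_L`, `P_R`; **`esup_projL_le` / `esup_projR_le`** (a weighted average does not
  exceed the maximum); `blocks_sum` (`A = Σ blocks`), `esup_le_blockSize`, `blockSize_le` (`N ≤ 9·esup`), linearity of the blocks,
  `blockSize_add_le`, and the blocks of averaged arrays (`blockPQ_projR = 0`, `blockPP_projL = blockPP`, …).

Everything is proved; no definitions.
-/

noncomputable section

namespace Summit.HubbardSuperconductivity.HubbardSuperconductivity.Theorems.SWaveCascade

set_option linter.dupNamespace false -- summit = problem name (single-conjunct summit), D-0017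

open Finset

variable {S : Type*} [Fintype S]

/-! ## §1 The weighted max-entry algebra -/

/-! ### `esup` -/

/-- Every entry is bounded by the max-entry size. -/
theorem le_esup (A : S → S → ℂ) (s t : S) : ‖A s t‖ ≤ esup A :=
  le_csSup (Set.finite_range _).bddAbove ⟨(s, t), rfl⟩

omit [Fintype S] in
/-- A uniform entry bound is a bound for the max-entry size. -/
theorem esup_le {A : S → S → ℂ} {x : ℝ} (h : ∀ s t, ‖A s t‖ ≤ x) (hx : 0 ≤ x) : esup A ≤ x :=
  Real.sSup_le (by rintro _ ⟨p, rfl⟩; exact h p.1 p.2) hx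

omit [Fintype S] in
/-- The max-entry size is nonnegative. -/
theorem esup_nonneg (A : S → S → ℂ) : 0 ≤ esup A :=
  Real.sSup_nonneg (by rintro _ ⟨p, rfl⟩; exact norm_nonneg _)

/-- Triangle inequality for the max-entry size (sum). -/
theorem esup_add_le (A B : S → S → ℂ) : esup (A + B) ≤ esup A + esup B :=
  esup_le (fun s t => (norm_add_le _ _).trans (add_le_add (le_esup A s t) (le_esup B s t)))
    (add_nonneg (esup_nonneg A) (esup_nonneg B))

/-- Triangle inequality for the max-entry size (difference). -/
theorem esup_sub_le (A B : S → S → ℂ) : esup (A - B) ≤ esup A + esup B :=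
  esup_le (fun s t => (norm_sub_le _ _).trans (add_le_add (le_esup A s t) (le_esup B s t)))
    (add_nonneg (esup_nonneg A) (esup_nonneg B))

/-- Scalars pull out of the max-entry size. -/
theorem esup_smul_le (c : ℂ) (A : S → S → ℂ) : esup (c • A) ≤ ‖c‖ * esup A :=
  esup_le (fun s t => by rw [Pi.smul_apply, Pi.smul_apply, smul_eq_mul, norm_mul]; gcongr; exact le_esup A s t)
    (mul_nonneg (norm_nonneg c) (esup_nonneg A))

/-! ### the weighted product -/

section Algebra

variable (w : S → ℝ)

/-- The weighted product is additive in the left factor. -/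
theorem wmul_add_left (A A' B : S → S → ℂ) : wmul w (A + A') B = wmul w A B + wmul w A' B := by
  funext s t; simp only [wmul, Pi.add_apply, add_mul, sum_add_distrib]

/-- The weighted product is additive in the right factor. -/
theorem wmul_add_right (A B B' : S → S → ℂ) : wmul w A (B + B') = wmul w A B + wmul w A B' := by
  funext s t; simp only [wmul, Pi.add_apply, mul_add, sum_add_distrib]

/-- The weighted product is subtractive in the left factor. -/
theorem wmul_sub_left (A A' B : S → S → ℂ) : wmul w (A - A') B = wmul w A B - wmul w A' B := by
  funext s t; simp only [wmul, Pi.sub_apply, sub_mul, sum_sub_distrib]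

/-- The weighted product is subtractive in the right factor. -/
theorem wmul_sub_right (A B B' : S → S → ℂ) : wmul w A (B - B') = wmul w A B - wmul w A B' := by
  funext s t; simp only [wmul, Pi.sub_apply, mul_sub, sum_sub_distrib]

/-- Scalars pull out of the left factor of the weighted product. -/
theorem wmul_smul_left (c : ℂ) (A B : S → S → ℂ) : wmul w (c • A) B = c • wmul w A B := by
  funext s t; simp only [wmul, Pi.smul_apply, smul_eq_mul, mul_sum]; exact sum_congr rfl fun u _ => by ring

/-- Scalars pull out of the right factor of the weighted product. -/
theorem wmul_smul_right (c : ℂ) (A B : S → S → ℂ) : wmul w A (c • B) = c • wmul w A B := by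
  funext s t; simp only [wmul, Pi.smul_apply, smul_eq_mul, mul_sum]; exact sum_congr rfl fun u _ => by ring

/-- `J ∗_w A = W · P_L A` (for `W ≠ 0`). -/
theorem wmul_onesArr_left {A : S → S → ℂ} (hW : (∑ u, w u) ≠ 0) :
    wmul w onesArr A = (((∑ u, w u : ℝ)) : ℂ) • projL w A := by
  funext s t
  have hW' : (((∑ u, w u : ℝ)) : ℂ) ≠ 0 := by exact_mod_cast hW
  simp only [wmul, onesArr, one_mul, projL, Pi.smul_apply, smul_eq_mul]
  rw [mul_div_cancel₀ _ hW']

/-- `A ∗_w J = W · P_R A` (for `W ≠ 0`). -/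
theorem wmul_onesArr_right {A : S → S → ℂ} (hW : (∑ u, w u) ≠ 0) :
    wmul w A onesArr = (((∑ u, w u : ℝ)) : ℂ) • projR w A := by
  funext s t
  have hW' : (((∑ u, w u : ℝ)) : ℂ) ≠ 0 := by exact_mod_cast hW
  simp only [wmul, onesArr, mul_one, projR, Pi.smul_apply, smul_eq_mul]
  rw [mul_div_cancel₀ _ hW']

/-- `J ∗_w J = W · J`. -/
theorem wmul_onesArr_onesArr : wmul w (onesArr : S → S → ℂ) onesArr = (((∑ u, w u : ℝ)) : ℂ) • onesArr := by
  funext s t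
  simp only [wmul, onesArr, one_mul, mul_one, Pi.smul_apply, smul_eq_mul, Complex.ofReal_sum]

/-- **Submultiplicativity**: `esup (A ∗_w B) ≤ esup A · W · esup B` (`w ≥ 0`). -/
theorem esup_wmul_le (hw : ∀ u, 0 ≤ w u) (A B : S → S → ℂ) : esup (wmul w A B) ≤ esup A * (∑ u, w u) * esup B := by
  refine esup_le (fun s t => ?_) (mul_nonneg (mul_nonneg (esup_nonneg A) (sum_nonneg fun u _ => hw u)) (esup_nonneg B))
  calc ‖wmul w A B s t‖ ≤ ∑ u, ‖A s u * (w u : ℂ) * B u t‖ := norm_sum_le _ _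
    _ ≤ ∑ u, esup A * w u * esup B := sum_le_sum fun u _ => by
        rw [norm_mul, norm_mul, Complex.norm_real, Real.norm_eq_abs, abs_of_nonneg (hw u)]
        exact mul_le_mul (mul_le_mul_of_nonneg_right (le_esup A s u) (hw u)) (le_esup B u t) (norm_nonneg _)
          (mul_nonneg (esup_nonneg A) (hw u))
    _ = esup A * (∑ u, w u) * esup B := by rw [mul_sum, sum_mul]

end Algebra


/-! ## §2 The averaging projections and the four blocks -/

section Proj

variable (w : S → ℝ)

/-- `P_L` is additive. -/
theorem projL_add (A B : S → S → ℂ) : projL w (A + B) = projL w A + projL w B := by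
  funext s t; simp only [projL, Pi.add_apply, mul_add, sum_add_distrib, add_div]

/-- `P_R` is additive. -/
theorem projR_add (A B : S → S → ℂ) : projR w (A + B) = projR w A + projR w B := by
  funext s t; simp only [projR, Pi.add_apply, add_mul, sum_add_distrib, add_div]

/-- `P_L` is subtractive. -/
theorem projL_sub (A B : S → S → ℂ) : projL w (A - B) = projL w A - projL w B := by
  funext s t; simp only [projL, Pi.sub_apply, mul_sub, sum_sub_distrib, sub_div]

/-- `P_R` is subtractive. -/
theorem projR_sub (A B : S → S → ℂ) : projR w (A - B) = projR w A - projR w B := by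
  funext s t; simp only [projR, Pi.sub_apply, sub_mul, sum_sub_distrib, sub_div]

/-- `P_L` commutes with scalars. -/
theorem projL_smul (c : ℂ) (A : S → S → ℂ) : projL w (c • A) = c • projL w A := by
  funext s t
  simp only [projL, Pi.smul_apply, smul_eq_mul, mul_sum, mul_div_assoc']
  congr 1
  exact sum_congr rfl fun u _ => by ring

/-- `P_R` commutes with scalars. -/
theorem projR_smul (c : ℂ) (A : S → S → ℂ) : projR w (c • A) = c • projR w A := by
  funext s t
  simp only [projR, Pi.smul_apply, smul_eq_mul, mul_sum, mul_div_assoc']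
  congr 1
  exact sum_congr rfl fun u _ => by ring

/-- `P_L 0 = 0`. -/
theorem projL_zero : projL w (0 : S → S → ℂ) = 0 := by
  funext s t; simp [projL]

/-- `P_R 0 = 0`. -/
theorem projR_zero : projR w (0 : S → S → ℂ) = 0 := by
  funext s t; simp [projR]

variable {w}

/-- `P_L` is idempotent (`W ≠ 0`). -/
theorem projL_projL (hW : (∑ u, w u) ≠ 0) (A : S → S → ℂ) : projL w (projL w A) = projL w A := by
  have hW' : (((∑ u, w u : ℝ)) : ℂ) ≠ 0 := by exact_mod_cast hW
  funext s t
  simp only [projL]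
  rw [← sum_mul, ← Complex.ofReal_sum, mul_div_cancel_left₀ _ hW']

/-- `P_R` is idempotent (`W ≠ 0`). -/
theorem projR_projR (hW : (∑ u, w u) ≠ 0) (A : S → S → ℂ) : projR w (projR w A) = projR w A := by
  have hW' : (((∑ u, w u : ℝ)) : ℂ) ≠ 0 := by exact_mod_cast hW
  funext s t
  simp only [projR]
  rw [← mul_sum, ← Complex.ofReal_sum, div_mul_cancel₀ _ hW']

omit [Fintype S] in
/-- Exchange of the two weighted sums (Fubini on the finite carrier). -/
private theorem sum_sum_aux [Fintype S] (A : S → S → ℂ) :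
    ∑ u, (w u : ℂ) * (∑ v, A u v * (w v : ℂ)) = ∑ v, (∑ u, (w u : ℂ) * A u v) * (w v : ℂ) := by
  simp only [mul_sum, sum_mul]
  rw [sum_comm]
  exact sum_congr rfl fun v _ => sum_congr rfl fun u _ => by ring

/-- `P_L` and `P_R` commute. -/
theorem projL_projR_comm (A : S → S → ℂ) : projL w (projR w A) = projR w (projL w A) := by
  funext s t
  simp only [projL, projR, mul_div_assoc', div_mul_eq_mul_div, ← Finset.sum_div]
  rw [sum_sum_aux]

/-- A weighted average does not exceed the maximum: `esup (P_L A) ≤ esup A`. -/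
theorem esup_projL_le (hw : ∀ u, 0 ≤ w u) (hW : 0 < ∑ u, w u) (A : S → S → ℂ) : esup (projL w A) ≤ esup A := by
  refine esup_le (fun s t => ?_) (esup_nonneg A)
  simp only [projL]
  rw [norm_div, Complex.norm_real, Real.norm_eq_abs, abs_of_pos hW, div_le_iff₀ hW]
  calc ‖∑ u, (w u : ℂ) * A u t‖ ≤ ∑ u, ‖(w u : ℂ) * A u t‖ := norm_sum_le _ _
    _ ≤ ∑ u, w u * esup A := sum_le_sum fun u _ => by
        rw [norm_mul, Complex.norm_real, Real.norm_eq_abs, abs_of_nonneg (hw u)]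
        exact mul_le_mul_of_nonneg_left (le_esup A u t) (hw u)
    _ = esup A * ∑ u, w u := by rw [← sum_mul, mul_comm]

/-- `esup (P_R A) ≤ esup A`. -/
theorem esup_projR_le (hw : ∀ u, 0 ≤ w u) (hW : 0 < ∑ u, w u) (A : S → S → ℂ) : esup (projR w A) ≤ esup A := by
  refine esup_le (fun s t => ?_) (esup_nonneg A)
  simp only [projR]
  rw [norm_div, Complex.norm_real, Real.norm_eq_abs, abs_of_pos hW, div_le_iff₀ hW]
  calc ‖∑ u, A s u * (w u : ℂ)‖ ≤ ∑ u, ‖A s u * (w u : ℂ)‖ := norm_sum_le _ _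
    _ ≤ ∑ u, esup A * w u := sum_le_sum fun u _ => by
        rw [norm_mul, Complex.norm_real, Real.norm_eq_abs, abs_of_nonneg (hw u)]
        exact mul_le_mul_of_nonneg_right (le_esup A s u) (hw u)
    _ = esup A * ∑ u, w u := by rw [← mul_sum]

variable (w)

/-- The four blocks add up to the array. -/
theorem blocks_sum (A : S → S → ℂ) : blockPP w A + blockPQ w A + blockQP w A + blockQQ w A = A := by
  funext s t
  simp only [blockPQ, blockQP, blockQQ, Pi.add_apply, Pi.sub_apply]
  ring

/-- `esup A ≤ N(A)`. -/
theorem esup_le_blockSize (A : S → S → ℂ) : esup A ≤ blockSize w A := by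
  have h1 := esup_add_le (blockPP w A + blockPQ w A + blockQP w A) (blockQQ w A)
  have h2 := esup_add_le (blockPP w A + blockPQ w A) (blockQP w A)
  have h3 := esup_add_le (blockPP w A) (blockPQ w A)
  rw [blocks_sum w A] at h1
  unfold blockSize
  linarith

/-- `0 ≤ N(A)`. -/
theorem blockSize_nonneg (A : S → S → ℂ) : 0 ≤ blockSize w A :=
  add_nonneg (add_nonneg (add_nonneg (esup_nonneg _) (esup_nonneg _)) (esup_nonneg _)) (esup_nonneg _)

variable {w}

/-- `N(A) ≤ 9 · esup A` (`PP ≤ 1`, `PQ, QP ≤ 2`, `QQ ≤ 4` maxima). -/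
theorem blockSize_le (hw : ∀ u, 0 ≤ w u) (hW : 0 < ∑ u, w u) (A : S → S → ℂ) : blockSize w A ≤ 9 * esup A := by
  have hPL := esup_projL_le hw hW A
  have hPR := esup_projR_le hw hW A
  have hPP : esup (blockPP w A) ≤ esup A := (esup_projL_le hw hW _).trans hPR
  have hPQ : esup (blockPQ w A) ≤ 2 * esup A := by
    unfold blockPQ; linarith [esup_sub_le (projL w A) (blockPP w A)]
  have hQP : esup (blockQP w A) ≤ 2 * esup A := by
    unfold blockQP; linarith [esup_sub_le (projR w A) (blockPP w A)]
  have hQQ : esup (blockQQ w A) ≤ 4 * esup A := by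
    unfold blockQQ
    linarith [esup_add_le (A - projL w A - projR w A) (blockPP w A), esup_sub_le (A - projL w A) (projR w A),
      esup_sub_le A (projL w A)]
  unfold blockSize
  linarith

/-! ### linearity of the blocks -/

variable (w)

/-- The `PP` block is additive. -/
theorem blockPP_add (A B : S → S → ℂ) : blockPP w (A + B) = blockPP w A + blockPP w B := by
  simp only [blockPP, projR_add, projL_add]

/-- The `PP` block is subtractive. -/
theorem blockPP_sub (A B : S → S → ℂ) : blockPP w (A - B) = blockPP w A - blockPP w B := by
  simp only [blockPP, projR_sub, projL_sub]

/-- The `PP` block commutes with scalars. -/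
theorem blockPP_smul (c : ℂ) (A : S → S → ℂ) : blockPP w (c • A) = c • blockPP w A := by
  simp only [blockPP, projR_smul, projL_smul]

/-- The `PQ` block is additive. -/
theorem blockPQ_add (A B : S → S → ℂ) : blockPQ w (A + B) = blockPQ w A + blockPQ w B := by
  simp only [blockPQ, projL_add, blockPP_add]; abel

/-- The `PQ` block is subtractive. -/
theorem blockPQ_sub (A B : S → S → ℂ) : blockPQ w (A - B) = blockPQ w A - blockPQ w B := by
  simp only [blockPQ, projL_sub, blockPP_sub]; abel

/-- The `PQ` block commutes with scalars. -/
theorem blockPQ_smul (c : ℂ) (A : S → S → ℂ) : blockPQ w (c • A) = c • blockPQ w A := by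
  simp only [blockPQ, projL_smul, blockPP_smul, smul_sub]

/-- The `QP` block is additive. -/
theorem blockQP_add (A B : S → S → ℂ) : blockQP w (A + B) = blockQP w A + blockQP w B := by
  simp only [blockQP, projR_add, blockPP_add]; abel

/-- The `QP` block is subtractive. -/
theorem blockQP_sub (A B : S → S → ℂ) : blockQP w (A - B) = blockQP w A - blockQP w B := by
  simp only [blockQP, projR_sub, blockPP_sub]; abel

/-- The `QP` block commutes with scalars. -/
theorem blockQP_smul (c : ℂ) (A : S → S → ℂ) : blockQP w (c • A) = c • blockQP w A := by
  simp only [blockQP, projR_smul, blockPP_smul, smul_sub]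

/-- The `QQ` block is additive. -/
theorem blockQQ_add (A B : S → S → ℂ) : blockQQ w (A + B) = blockQQ w A + blockQQ w B := by
  simp only [blockQQ, projL_add, projR_add, blockPP_add]; abel

/-- The `QQ` block is subtractive. -/
theorem blockQQ_sub (A B : S → S → ℂ) : blockQQ w (A - B) = blockQQ w A - blockQQ w B := by
  simp only [blockQQ, projL_sub, projR_sub, blockPP_sub]; abel

/-- The `QQ` block commutes with scalars. -/
theorem blockQQ_smul (c : ℂ) (A : S → S → ℂ) : blockQQ w (c • A) = c • blockQQ w A := by
  simp only [blockQQ, projL_smul, projR_smul, blockPP_smul, smul_sub, smul_add]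

/-- The block size is subadditive. -/
theorem blockSize_add_le (A B : S → S → ℂ) : blockSize w (A + B) ≤ blockSize w A + blockSize w B := by
  simp only [blockSize, blockPP_add, blockPQ_add, blockQP_add, blockQQ_add]
  linarith [esup_add_le (blockPP w A) (blockPP w B), esup_add_le (blockPQ w A) (blockPQ w B),
    esup_add_le (blockQP w A) (blockQP w B), esup_add_le (blockQQ w A) (blockQQ w B)]

/-! ### blocks of averaged arrays -/

variable {w}

/-- `PP` block of a row-averaged array. -/
theorem blockPP_projR (hW : (∑ u, w u) ≠ 0) (X : S → S → ℂ) : blockPP w (projR w X) = blockPP w X := by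
  simp only [blockPP, projR_projR hW]

/-- `PP` block of a column-averaged array. -/
theorem blockPP_projL (hW : (∑ u, w u) ≠ 0) (X : S → S → ℂ) : blockPP w (projL w X) = blockPP w X := by
  simp only [blockPP, ← projL_projR_comm, projL_projL hW]

/-- `PQ` block of a row-averaged array vanishes. -/
theorem blockPQ_projR (hW : (∑ u, w u) ≠ 0) (X : S → S → ℂ) : blockPQ w (projR w X) = 0 := by
  simp only [blockPQ, blockPP, projR_projR hW, sub_self]

/-- `PQ` block of a column-averaged array. -/
theorem blockPQ_projL (hW : (∑ u, w u) ≠ 0) (X : S → S → ℂ) : blockPQ w (projL w X) = blockPQ w X := by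
  simp only [blockPQ, blockPP, projL_projL hW, ← projL_projR_comm]

/-- `QP` block of a row-averaged array. -/
theorem blockQP_projR (hW : (∑ u, w u) ≠ 0) (X : S → S → ℂ) : blockQP w (projR w X) = blockQP w X := by
  simp only [blockQP, blockPP, projR_projR hW]

/-- `QP` block of a column-averaged array vanishes. -/
theorem blockQP_projL (hW : (∑ u, w u) ≠ 0) (X : S → S → ℂ) : blockQP w (projL w X) = 0 := by
  simp only [blockQP, blockPP, ← projL_projR_comm, projL_projL hW, sub_self]

/-- `QQ` block of a column-averaged array vanishes. -/
theorem blockQQ_projL (hW : (∑ u, w u) ≠ 0) (X : S → S → ℂ) : blockQQ w (projL w X) = 0 := by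
  simp only [blockQQ, blockPP, projL_projL hW, ← projL_projR_comm]
  abel

/-- `QQ` block of a row-averaged array vanishes. -/
theorem blockQQ_projR (hW : (∑ u, w u) ≠ 0) (X : S → S → ℂ) : blockQQ w (projR w X) = 0 := by
  simp only [blockQQ, blockPP, projR_projR hW, projL_projR_comm]
  abel

end Proj


end Summit.HubbardSuperconductivity.HubbardSuperconductivity.Theorems.SWaveCascade

end
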